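import Summits.QuantumAdvantage.QuantumAdvantage.Theses.LinnikCubicClassGroups
import Summits.QuantumAdvantage.QuantumAdvantage.Theorems.LinnikCubicClassGroupsPureCubicClassGroupFBQPStubPureCubicOrder
import Summits.QuantumAdvantage.QuantumAdvantage.Theorems.LinnikCubicClassGroupsPureCubicClassGroupFBQPStubLllEnumeration
import Summits.QuantumAdvantage.QuantumAdvantage.Theorems.LinnikCubicClassGroupsPureCubicClassGroupFBQPStubCubicReduction
import Summits.QuantumAdvantage.QuantumAdvantage.Theorems.LinnikCubicClassGroupsPureCubicClassGroupFBQPStubCubicFilteredCycle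
import Summits.QuantumAdvantage.QuantumAdvantage.Theorems.LinnikCubicClassGroupsPureCubicClassGroupFBQPStubCubicLogFP
import Summits.QuantumAdvantage.QuantumAdvantage.Theorems.LinnikCubicClassGroupsPureCubicClassGroupFBQPStubCubicLatticeFP
import Summits.QuantumAdvantage.QuantumAdvantage.Theorems.LinnikCubicClassGroupsPureCubicClassGroupFBQPStubCubicOrderFP
import Summits.QuantumAdvantage.QuantumAdvantage.Theorems.LinnikCubicClassGroupsPureCubicClassGroupFBQPStubCubicWalkOpsFP
import Summits.QuantumAdvantage.QuantumAdvantage.Theorems.LinnikCubicClassGroupsPureCubicClassGroupFBQPStubRegulatorWrap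
import Summits.QuantumAdvantage.QuantumAdvantage.Theorems.LinnikCubicClassGroupsPureCubicClassGroupFBQPStubPacking
import Summits.QuantumAdvantage.QuantumAdvantage.Theorems.LinnikCubicClassGroupsPureCubicClassGroupFBQPStubRegulatorPeriod
import Summits.QuantumAdvantage.QuantumAdvantage.Theorems.LinnikCubicClassGroupsPureCubicClassGroupFBQPStubCubicFieldFacts
import Summits.QuantumAdvantage.QuantumAdvantage.Theorems.LinnikCubicClassGroupsPureCubicClassGroupFBQPStubGeneration
import Summits.QuantumAdvantage.QuantumAdvantage.Theorems.LinnikCubicClassGroupsPureCubicClassGroupFBQPStubVoronoiChain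
import Summits.QuantumAdvantage.QuantumAdvantage.Theorems.LinnikCubicClassGroupsPureCubicClassGroupFBQPStubAdmissibleFields
import Summits.QuantumAdvantage.QuantumAdvantage.Theorems.LinnikCubicClassGroupsPureCubicClassGroupFBQPStubCoreOrderCanonical
import Summits.QuantumAdvantage.QuantumAdvantage.Theorems.LinnikCubicClassGroupsPureCubicClassGroupFBQPStubRelationLatticeIndex
import Summits.QuantumAdvantage.QuantumAdvantage.Theorems.LinnikCubicClassGroupsPureCubicClassGroupFBQPStubAssemblyCore
import Literature.Computability.Complexity.CoinBlockRejectionSampling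
import Literature.Computability.Complexity.CountingHierarchyProofs
import Literature.Computability.Complexity.AlgebraicQueryRectangles
import Summits.QuantumAdvantage.QuantumAdvantage.Theorems.LinnikCubicClassGroupsPureCubicClassGroupFBQPStubAssemblyFields
import Literature.Computability.Complexity.OracleJoin
import Literature.Computability.Cryptography.HallgrenPellQuantum
import Literature.Computability.Cryptography.ShorProofs
import Literature.Computability.Cryptography.HallgrenCandidateCheckFP
import Literature.NumberTheory.CubicFields.PureCubicLatticeCodes
import Literature.Algebra.EuclideanLattices.LLL
import Summits.QuantumAdvantage.QuantumAdvantage.Theorems.LinnikCubicClassGroupsPureCubicClassGroupFBQPStubAssemblyCoins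
import Summits.QuantumAdvantage.QuantumAdvantage.Theorems.LinnikCubicClassGroupsPureCubicClassGroupFBQPStubAssemblySamplerAcc
import Summits.QuantumAdvantage.QuantumAdvantage.Theorems.LinnikCubicClassGroupsPureCubicClassGroupFBQPStubAssemblySampler
import Summits.QuantumAdvantage.QuantumAdvantage.Theorems.LinnikCubicClassGroupsPureCubicClassGroupFBQPStubAssembly
import Summits.QuantumAdvantage.QuantumAdvantage.Theorems.LinnikCubicClassGroupsPureCubicClassGroupFBQPStubRegulatorGeneric
import Summits.QuantumAdvantage.QuantumAdvantage.Theorems.LinnikCubicClassGroupsPureCubicClassGroupFBQPStubCubicSSParams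
import Literature.Computability.Cryptography.CubicClassStageSpecs
import Summits.QuantumAdvantage.QuantumAdvantage.Theorems.LinnikCubicClassGroupsPureCubicClassGroupFBQPStubCubeRootsModP
import Summits.QuantumAdvantage.QuantumAdvantage.Theorems.LinnikCubicClassGroupsPureCubicClassGroupFBQPStubDegreeOnePrimeCodes
import Summits.QuantumAdvantage.QuantumAdvantage.Theorems.LinnikCubicClassGroupsPureCubicClassGroupFBQPStubAdviceChain
import Summits.QuantumAdvantage.QuantumAdvantage.Theorems.LinnikCubicClassGroupsPureCubicClassGroupFBQPStubCubicLexMinFP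
import Summits.QuantumAdvantage.QuantumAdvantage.Theorems.LinnikCubicClassGroupsPureCubicClassGroupFBQPStubCubicGiantStepCycle
import Summits.QuantumAdvantage.QuantumAdvantage.Theorems.LinnikCubicClassGroupsPureCubicClassGroupFBQPStubClassTableProg
import Summits.QuantumAdvantage.QuantumAdvantage.Theorems.LinnikCubicClassGroupsPureCubicClassGroupFBQPStubClassPost
import Summits.QuantumAdvantage.QuantumAdvantage.Theorems.LinnikCubicClassGroupsPureCubicClassGroupFBQPStubClassStageAssembly
import Literature.Computability.Cryptography.CubicClassSamplingSpecs

/-!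
# Crux `LinnikCubicClassGroups.PureCubicClassGroupFBQP` (stmt-QuantumAdvantage-11544) — the composition of line `arakelov-giant-step-cycle`

The composition of the registered skeleton of line `arakelov-giant-step-cycle` (crux directory
`Cruxes/PureCubicClassGroupFBQP/Lines/arakelov_giant_step_cycle.lean`, leads 1 / c1 / c2) over its LANDED stubs, all in this
namespace (`…Theorems.LinnikCubicClassGroupsPureCubicClassGroupFBQPStub*.lean`): S1 `stub_packing`, S2 `stub_regulatorPeriod`,
S3a `stub_voronoiChain`, S3c `stub_admissibleFields`, T2 `stub_regulatorGeneric`, T3a `stub_cubicFilteredCycle`, T3a′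
`stub_cubicReduction`, B `stub_pureCubicOrder`, C `stub_lllEnumeration`, G1–G4 `stub_cubicLatticeFP`, `stub_cubicLexMinFP`,
`stub_cubicLogFP`, `stub_cubicOrderFP`, P4 `stub_cubicWalkOpsFP`, W1 `stub_cubicGiantStepCycle`, W2 `stub_regulatorWrap`, S4a
`stub_cubicFieldFacts`, S4b `stub_generation`, S5a `stub_coreOrderCanonical`, S5c `stub_relationLatticeIndex`, P1 `stub_cubicSSParams`,
P2 `stub_cubeRootsModP`, P3 `stub_degreeOnePrimeCodes`, P8 `stub_adviceChain`, P5a `stub_classTableProg`,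
P7 `stub_classPost`, ASM `stub_classStageAssembly`, S6a–S6 `stub_assemblyCore`, `stub_assemblySamplerAcc`,
`stub_assemblySampler`, `stub_assemblyCoins`, `stub_assemblyFields`, `stub_assembly`:

* `regulator_of_parts` — S3b, the regulator of `ℚ(∛m)` in quantum polynomial time (no GRH);
* `classStage_of_parts` — S5b-P9, the class-group stage given regulator advice;
* `subgroupOrder_of_parts` — S5b, the order of the subgroup generated by given degree-one primes;
* `crux_conclusion_of_canonical`, `PureCubicClassGroupFBQP_of_parts` — S6 + the canonical relation give the crux BY NAME, modulo the two
  stubs still open at this point (P5b `stub_classTableSem : ClaimTableSem`, P6 `stub_classSamplingLaw : ClaimSamplingLaw`), taken as hypotheses.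
-/

set_option linter.unusedVariables false
-- the problem namespace repeats the summit name (`QuantumAdvantage.QuantumAdvantage`)
set_option linter.dupNamespace false

namespace Summit.QuantumAdvantage.QuantumAdvantage.Theorems.LinnikCubicClassGroups

open Computability (encodeNat decodeNat)
open Literature.Computability.Cryptography (IsQSolvable FBQP BQP QCircuitFamily cliffordT)
open Literature.Computability.Complexity (boolPair boolUnpair encodingListNatBool FP FPRel Oracle oracleJoin uniformProb
  bitsToNat)
open scoped NumberField
open Summit.QuantumAdvantage.QuantumAdvantage.Theses.LinnikCubicClassGroups
  (DegreeOnePrimesEscape PureCubicClassGroupFBQP)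
open Literature.Computability.Complexity (uniformProb_univ uniformProb_take_of_le uniformProb_blockRejection_le
  decodeNat_lt_two_pow_succ)
open scoped nonZeroDivisors
open Literature.Computability.Cryptography (GiantStepCycle WalkData IntWalkOps)
open Literature.Computability.Cryptography.HallgrenQuantum (Ngrid LQ Tdbl)
open Literature.Computability.Complexity (CodeFP)
open Literature.Computability.Complexity.CodeFP (pairE strE natE intE bitE unE rawE)
open Literature.NumberTheory.CubicFields (posRelMinima voronoiChain voronoiSucc relMinima)
open Literature.Algebra.EuclideanLattices (IsLLLReduced)
open Literature.NumberTheory.CubicFields (PureCubicCodes.Mem PureCubicCodes.Canon)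
open Literature.Computability.Cryptography (ShiftSampling.SSParams)
open Literature.Computability.Cryptography.PeriodFinding (ηacc)
open Literature.Computability.Cryptography.CubicClassSampling (ClaimLexMin ClaimTableFP ClaimTableSem ClaimSamplingLaw ClaimPost)
open Literature.Computability.Cryptography.CubicClassStage (ClassStageGoal)

/-- **S3b (composition, sorry-free; skeleton v11b dissolves the former glue stub `stub_regulatorInstance` — its hypotheses T2, T3a, T3a′,
B, C, G1–G4 are all registered/landed stubs — into this theorem): the regulator of `ℚ(∛m)` in quantum polynomial time, no GRH**, in the interface
consumed by S5b: on input `⟨⟨x, ⟨f, a, b⟩⟩, 1^k⟩` with `m = decodeNat x = f³ab²`, `ab` squarefree, `m` not a cube, output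
`⟨bin r, ·⟩` with `|r − 2^k R_K| ≤ 1` for every cubic `K ∋ ∛m`. -/
theorem regulator_of_parts :
    IsQSolvable fun w => {y | ∀ (x : List Bool) (f a b k : ℕ),
      w = boolPair (boolPair x (boolPair (encodeNat f) (boolPair (encodeNat a) (encodeNat b)))) (List.replicate k true) →
      decodeNat x = f ^ 3 * (a * b ^ 2) → Squarefree (a * b) →
      ∀ (K : Type) [Field K] [NumberField K], Module.finrank ℚ K = 3 →
        (∀ r : ℕ, r ^ 3 ≠ decodeNat x) → (∃ α : K, α ^ 3 = (decodeNat x : K)) →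
        ∃ (r : ℕ) (t : List Bool), y = boolPair (encodeNat r) t ∧
          |(r : ℝ) - 2 ^ k * NumberField.Units.regulator K| ≤ 1} := by
  -- skeleton v11b: the former GLUE stub `stub_regulatorInstance` is dissolved into this composition of P4, W1, W2 (and the landed parts)
  have hB := stub_pureCubicOrder
  have hG1' := stub_cubicLatticeFP hB
  obtain ⟨mulE, normE, latScale, latProd, latAddGen, hmulE, hnormE, hlatScale, hlatProd, hlatAddGen, hG1spec⟩ := stub_cubicLatticeFP hB
  obtain ⟨lexE, hlexE, hG2spec⟩ := stub_cubicLexMinFP stub_cubicReduction hB stub_lllEnumeration hG1'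
  obtain ⟨logE, hlogE, hG3spec⟩ := stub_cubicLogFP
  obtain ⟨ordL, hordL, hG4spec⟩ := stub_cubicOrderFP hB hG1'
  obtain ⟨invE, redL, isBigL, rhoS, starS, unitS, _hinvE, _hredL, _hisBigL, hrhoS, hstarS, hunitS, hP4alg, hP4rho, hP4star,
      hP4unit⟩ :=
    stub_cubicWalkOpsFP mulE normE latScale latProd lexE logE ordL hmulE hnormE hlatScale hlatProd hlexE hlogE hordL hB (by
      intro a b hsq hab K _ _ hdeg θ hθ
      have hind := (hB a b hsq hab K hdeg θ hθ).2.2.2.1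
      exact ⟨(hG1spec a b hsq hab K hdeg θ hθ hind).1, (hG1spec a b hsq hab K hdeg θ hθ hind).2.1⟩)
  have hW1 := stub_cubicGiantStepCycle mulE normE latScale latProd latAddGen lexE logE ordL invE redL isBigL rhoS starS unitS
    stub_cubicFilteredCycle stub_cubicReduction hB
    Summit.QuantumAdvantage.QuantumAdvantage.Theorems.LinnikCubicClassGroups.stub_cubicFieldFacts stub_admissibleFields hG1spec
    hG2spec hG3spec hG4spec ⟨hP4alg, hP4rho, hP4star, hP4unit⟩
  exact stub_regulatorWrap rhoS starS unitS hrhoS hstarS hunitS stub_regulatorGeneric hB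
    Summit.QuantumAdvantage.QuantumAdvantage.Theorems.LinnikCubicClassGroups.stub_cubicFieldFacts hW1

/-- **S5b-P9 (composition, sorry-free since skeleton v16)**: the former umbrella stub `stub_classStage`, now derived from the five parts
(its hypotheses P2, S5c, S5a are no longer needed here: P2 is landed and consumed inside the assembly). -/
theorem classStage_of_parts (hSem : ClaimTableSem) (hLaw : ClaimSamplingLaw) :
    -- P2 (cube roots modulo p)
    (∃ roots : ℕ × ℕ × List Bool → List ℕ, CodeFP (pairE natE (pairE natE strE)) (rawE natE) roots ∧
      ∀ (p m : ℕ), p.Prime → ¬ p ∣ 3 * m → ∀ (s ℓ : ℕ), (s + 1) * (24 * (Nat.size p + 2)) ≤ ℓ →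
        uniformProb ℓ {κ | roots (p, m, κ) ≠ (List.range p).filter (fun r => r ^ 3 % p = m % p)} ≤ (1 / 2) ^ s) →
    -- S5c (relation lattice index) and S5a-canonicity, as for the former glue
    (∀ (G : Type) [CommGroup G] (T : ℕ) (c : Fin T → G),
      ∃ φ : Multiplicative (Fin T → ℤ) →* G, (∀ v : Fin T → ℤ, φ (Multiplicative.ofAdd v) = ∏ i, c i ^ v i) ∧
        φ.ker.index = Nat.card (Subgroup.closure (Set.range c))) →
    (∀ (m : ℕ) (ps : List ℕ), (∀ r : ℕ, r ^ 3 ≠ m) →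
      ∀ (K : Type) [Field K] [NumberField K] (K' : Type) [Field K'] [NumberField K'],
        Module.finrank ℚ K = 3 → (∃ α : K, α ^ 3 = (m : K)) →
        Module.finrank ℚ K' = 3 → (∃ α' : K', α' ^ 3 = (m : K')) →
        Nat.card (Subgroup.closure {c : ClassGroup (𝓞 K) | ∃ p ∈ ps, ∃ P : Ideal (𝓞 K),
            ∃ hP : P ∈ nonZeroDivisors (Ideal (𝓞 K)), P.IsPrime ∧ Ideal.absNorm P = p ∧ c = ClassGroup.mk0 ⟨P, hP⟩}) =
          Nat.card (Subgroup.closure {c : ClassGroup (𝓞 K') | ∃ p ∈ ps, ∃ P : Ideal (𝓞 K'),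
            ∃ hP : P ∈ nonZeroDivisors (Ideal (𝓞 K')), P.IsPrime ∧ Ideal.absNorm P = p ∧ c = ClassGroup.mk0 ⟨P, hP⟩})) →
    (∃ qry : List Bool → List Bool, qry ∈ FP ∧
      (∀ w, (fun w : List Bool => ∃ (x : List Bool) (f a b : ℕ) (ps : List ℕ), w = boolPair x (boolPair (boolPair (encodeNat f) (boolPair (encodeNat a) (encodeNat b))) (encodingListNatBool.encode ps)) ∧
        decodeNat x = f ^ 3 * (a * b ^ 2) ∧ Squarefree (a * b) ∧ (∀ r : ℕ, r ^ 3 ≠ decodeNat x) ∧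
        ∀ p ∈ ps, p.Prime ∧ ¬ p ∣ 3 * decodeNat x) w →
        (fun q : List Bool => ∃ (x : List Bool) (f a b k : ℕ), q = boolPair (boolPair x (boolPair (encodeNat f) (boolPair (encodeNat a) (encodeNat b)))) (List.replicate k true) ∧
        decodeNat x = f ^ 3 * (a * b ^ 2) ∧ Squarefree (a * b) ∧ ∀ r : ℕ, r ^ 3 ≠ decodeNat x) (qry w)) ∧
      ∃ (pre post : List Bool → List Bool), pre ∈ FP ∧ post ∈ FP ∧
        ∃ F : QCircuitFamily cliffordT, F.IsOracleFree ∧ F.IsUniform ∧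
          ∀ (w : List Bool) (r : ℕ), (fun w : List Bool => ∃ (x : List Bool) (f a b : ℕ) (ps : List ℕ), w = boolPair x (boolPair (boolPair (encodeNat f) (boolPair (encodeNat a) (encodeNat b))) (encodingListNatBool.encode ps)) ∧
        decodeNat x = f ^ 3 * (a * b ^ 2) ∧ Squarefree (a * b) ∧ (∀ r : ℕ, r ^ 3 ≠ decodeNat x) ∧
        ∀ p ∈ ps, p.Prime ∧ ¬ p ∣ 3 * decodeNat x) w →
            (fun (q : List Bool) (r : ℕ) => ∀ (x : List Bool) (f a b k : ℕ), q = boolPair (boolPair x (boolPair (encodeNat f) (boolPair (encodeNat a) (encodeNat b)))) (List.replicate k true) →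
        decodeNat x = f ^ 3 * (a * b ^ 2) → Squarefree (a * b) →
        ∀ (K : Type) [Field K] [NumberField K], Module.finrank ℚ K = 3 →
          (∀ r' : ℕ, r' ^ 3 ≠ decodeNat x) → (∃ α : K, α ^ 3 = (decodeNat x : K)) →
          |(r : ℝ) - 2 ^ k * NumberField.Units.regulator K| ≤ 1) (qry w) r →
            (11 : ℝ) / 12 ≤ F.kernelProb 0 (pre (boolPair w (encodeNat r)))
              {y | (fun (w o : List Bool) => ∀ (x : List Bool) (f a b : ℕ) (ps : List ℕ), w = boolPair x (boolPair (boolPair (encodeNat f) (boolPair (encodeNat a) (encodeNat b))) (encodingListNatBool.encode ps)) →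
        decodeNat x = f ^ 3 * (a * b ^ 2) → Squarefree (a * b) →
        ∀ (K : Type) [Field K] [NumberField K], Module.finrank ℚ K = 3 →
          (∀ r : ℕ, r ^ 3 ≠ decodeNat x) → (∃ α : K, α ^ 3 = (decodeNat x : K)) →
          (∀ p ∈ ps, p.Prime ∧ ¬ p ∣ 3 * decodeNat x) →
          o = encodeNat (Nat.card (Subgroup.closure
            {c : ClassGroup (𝓞 K) | ∃ p ∈ ps, ∃ P : Ideal (𝓞 K), ∃ hP : P ∈ nonZeroDivisors (Ideal (𝓞 K)),
              P.IsPrime ∧ Ideal.absNorm P = p ∧ c = ClassGroup.mk0 ⟨P, hP⟩}))) w (post (boolPair (boolPair w (encodeNat r)) y))}) ∧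
    -- format lemmas: the regulator relation refines the advice relation; the chain's goal refines S5b's relation
    (∀ (q : List Bool) (y : List Bool), y ∈ (fun w => {y | ∀ (x : List Bool) (f a b k : ℕ),
      w = boolPair (boolPair x (boolPair (encodeNat f) (boolPair (encodeNat a) (encodeNat b)))) (List.replicate k true) →
      decodeNat x = f ^ 3 * (a * b ^ 2) → Squarefree (a * b) →
      ∀ (K : Type) [Field K] [NumberField K], Module.finrank ℚ K = 3 →
        (∀ r : ℕ, r ^ 3 ≠ decodeNat x) → (∃ α : K, α ^ 3 = (decodeNat x : K)) →
        ∃ (r : ℕ) (t : List Bool), y = boolPair (encodeNat r) t ∧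
          |(r : ℝ) - 2 ^ k * NumberField.Units.regulator K| ≤ 1}) q →
      y ∈ {y | (fun q : List Bool => ∃ (x : List Bool) (f a b k : ℕ), q = boolPair (boolPair x (boolPair (encodeNat f) (boolPair (encodeNat a) (encodeNat b)))) (List.replicate k true) ∧
        decodeNat x = f ^ 3 * (a * b ^ 2) ∧ Squarefree (a * b) ∧ ∀ r : ℕ, r ^ 3 ≠ decodeNat x) q → ∃ (r : ℕ) (t : List Bool), y = boolPair (encodeNat r) t ∧ (fun (q : List Bool) (r : ℕ) => ∀ (x : List Bool) (f a b k : ℕ), q = boolPair (boolPair x (boolPair (encodeNat f) (boolPair (encodeNat a) (encodeNat b)))) (List.replicate k true) →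
        decodeNat x = f ^ 3 * (a * b ^ 2) → Squarefree (a * b) →
        ∀ (K : Type) [Field K] [NumberField K], Module.finrank ℚ K = 3 →
          (∀ r' : ℕ, r' ^ 3 ≠ decodeNat x) → (∃ α : K, α ^ 3 = (decodeNat x : K)) →
          |(r : ℝ) - 2 ^ k * NumberField.Units.regulator K| ≤ 1) q r}) ∧
    (∀ (w : List Bool) (z : List Bool),
      z ∈ {z | (fun w : List Bool => ∃ (x : List Bool) (f a b : ℕ) (ps : List ℕ), w = boolPair x (boolPair (boolPair (encodeNat f) (boolPair (encodeNat a) (encodeNat b))) (encodingListNatBool.encode ps)) ∧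
        decodeNat x = f ^ 3 * (a * b ^ 2) ∧ Squarefree (a * b) ∧ (∀ r : ℕ, r ^ 3 ≠ decodeNat x) ∧
        ∀ p ∈ ps, p.Prime ∧ ¬ p ∣ 3 * decodeNat x) w → ∃ (o t : List Bool), z = boolPair o t ∧ (fun (w o : List Bool) => ∀ (x : List Bool) (f a b : ℕ) (ps : List ℕ), w = boolPair x (boolPair (boolPair (encodeNat f) (boolPair (encodeNat a) (encodeNat b))) (encodingListNatBool.encode ps)) →
        decodeNat x = f ^ 3 * (a * b ^ 2) → Squarefree (a * b) →
        ∀ (K : Type) [Field K] [NumberField K], Module.finrank ℚ K = 3 →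
          (∀ r : ℕ, r ^ 3 ≠ decodeNat x) → (∃ α : K, α ^ 3 = (decodeNat x : K)) →
          (∀ p ∈ ps, p.Prime ∧ ¬ p ∣ 3 * decodeNat x) →
          o = encodeNat (Nat.card (Subgroup.closure
            {c : ClassGroup (𝓞 K) | ∃ p ∈ ps, ∃ P : Ideal (𝓞 K), ∃ hP : P ∈ nonZeroDivisors (Ideal (𝓞 K)),
              P.IsPrime ∧ Ideal.absNorm P = p ∧ c = ClassGroup.mk0 ⟨P, hP⟩}))) w o} → z ∈ (fun w => {y | ∀ (x : List Bool) (f a b : ℕ) (ps : List ℕ),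
        w = boolPair x (boolPair (boolPair (encodeNat f) (boolPair (encodeNat a) (encodeNat b))) (encodingListNatBool.encode ps)) →
        decodeNat x = f ^ 3 * (a * b ^ 2) → Squarefree (a * b) →
        ∀ (K : Type) [Field K] [NumberField K], Module.finrank ℚ K = 3 →
          (∀ r : ℕ, r ^ 3 ≠ decodeNat x) → (∃ α : K, α ^ 3 = (decodeNat x : K)) →
          (∀ p ∈ ps, p.Prime ∧ ¬ p ∣ 3 * decodeNat x) →
          ∃ t : List Bool, y = boolPair (encodeNat (Nat.card (Subgroup.closure
            {c : ClassGroup (𝓞 K) | ∃ p ∈ ps, ∃ P : Ideal (𝓞 K), ∃ hP : P ∈ nonZeroDivisors (Ideal (𝓞 K)),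
              P.IsPrime ∧ Ideal.absNorm P = p ∧ c = ClassGroup.mk0 ⟨P, hP⟩}))) t}) w) ∧
    (∀ (q : List Bool) (r₁ r₂ r : ℕ), (fun (q : List Bool) (r : ℕ) => ∀ (x : List Bool) (f a b k : ℕ), q = boolPair (boolPair x (boolPair (encodeNat f) (boolPair (encodeNat a) (encodeNat b)))) (List.replicate k true) →
        decodeNat x = f ^ 3 * (a * b ^ 2) → Squarefree (a * b) →
        ∀ (K : Type) [Field K] [NumberField K], Module.finrank ℚ K = 3 →
          (∀ r' : ℕ, r' ^ 3 ≠ decodeNat x) → (∃ α : K, α ^ 3 = (decodeNat x : K)) →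
          |(r : ℝ) - 2 ^ k * NumberField.Units.regulator K| ≤ 1) q r₁ → (fun (q : List Bool) (r : ℕ) => ∀ (x : List Bool) (f a b k : ℕ), q = boolPair (boolPair x (boolPair (encodeNat f) (boolPair (encodeNat a) (encodeNat b)))) (List.replicate k true) →
        decodeNat x = f ^ 3 * (a * b ^ 2) → Squarefree (a * b) →
        ∀ (K : Type) [Field K] [NumberField K], Module.finrank ℚ K = 3 →
          (∀ r' : ℕ, r' ^ 3 ≠ decodeNat x) → (∃ α : K, α ^ 3 = (decodeNat x : K)) →
          |(r : ℝ) - 2 ^ k * NumberField.Units.regulator K| ≤ 1) q r₂ → r₁ ≤ r → r ≤ r₂ → (fun (q : List Bool) (r : ℕ) => ∀ (x : List Bool) (f a b k : ℕ), q = boolPair (boolPair x (boolPair (encodeNat f) (boolPair (encodeNat a) (encodeNat b)))) (List.replicate k true) →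
        decodeNat x = f ^ 3 * (a * b ^ 2) → Squarefree (a * b) →
        ∀ (K : Type) [Field K] [NumberField K], Module.finrank ℚ K = 3 →
          (∀ r' : ℕ, r' ^ 3 ≠ decodeNat x) → (∃ α : K, α ^ 3 = (decodeNat x : K)) →
          |(r : ℝ) - 2 ^ k * NumberField.Units.regulator K| ≤ 1) q r) := by
  intro _hP2 _hS5c _hS5a
  have hG2 : ClaimLexMin := by
    obtain ⟨lexE, hlexE, hspec⟩ := stub_cubicLexMinFP stub_cubicReduction stub_pureCubicOrder stub_lllEnumeration
      (stub_cubicLatticeFP stub_pureCubicOrder)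
    exact ⟨lexE, hlexE, fun a b hsq hab K _ _ hdeg θ hθ σ₁ σ₂ hσ₂ c hc hI => hspec a b hsq hab K hdeg θ hθ σ₁ σ₂ hσ₂ c hc hI⟩
  exact stub_classStageAssembly hG2 stub_classTableProg hSem hLaw stub_classPost

/-- **From the canonical search problem to the crux's conclusion.** If `Rcanon` is `IsQSolvable` then the
crux's `∃ f ∈ FBQP …` holds: (1) success probability `2/3 > 0` makes `Rcanon x` NONEMPTY for every `x`; (2) choose
a member and let `f x` be its `2|x|+8`-bit word `v`; (3) the word is the SAME for every member of `Rcanon x` — by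
the `∀ K` clause when an admissible `K` exists (this is where well-definedness of `h` across admissible `K` drops
out: two admissible fields both pin `v`), by the zero clause otherwise — so `Rcanon x ⊆ {y | f x <+: y}` and
`IsQSolvable.mono` gives `f ∈ FBQP`; (4) length and value clauses are read off the relation. -/
theorem crux_conclusion_of_canonical
    (h : IsQSolvable fun x => {y | ∃ v : List Bool, v.length = 2 * x.length + 8 ∧ v <+: y ∧
      (∀ (K : Type) [Field K] [NumberField K], Module.finrank ℚ K = 3 →
        (∀ r : ℕ, r ^ 3 ≠ decodeNat x) → (∃ α : K, α ^ 3 = (decodeNat x : K)) →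
        v = List.ofFn (fun i : Fin (2 * x.length + 8) => (NumberField.classNumber K).testBit i.val)) ∧
      ((¬ ∃ (K : Type) (_ : Field K) (_ : NumberField K), Module.finrank ℚ K = 3 ∧
          (∀ r : ℕ, r ^ 3 ≠ decodeNat x) ∧ ∃ α : K, α ^ 3 = (decodeNat x : K)) →
        v = List.replicate (2 * x.length + 8) false)}) :
    ∃ f : List Bool → List Bool, f ∈ FBQP ∧ (∀ x, (f x).length = 2 * x.length + 8) ∧
      ∀ (x : List Bool) (K : Type) [Field K] [NumberField K], Module.finrank ℚ K = 3 →
        (∀ r : ℕ, r ^ 3 ≠ decodeNat x) → (∃ α : K, α ^ 3 = (decodeNat x : K)) →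
        f x = List.ofFn (fun i : Fin (2 * x.length + 8) => (NumberField.classNumber K).testBit i.val) := by
  obtain ⟨F, hfree, hU, hF⟩ := h
  -- (1) the relation is nonempty on every input
  have hne : ∀ x : List Bool, ∃ y : List Bool, ∃ v : List Bool, v.length = 2 * x.length + 8 ∧ v <+: y ∧
      (∀ (K : Type) [Field K] [NumberField K], Module.finrank ℚ K = 3 →
        (∀ r : ℕ, r ^ 3 ≠ decodeNat x) → (∃ α : K, α ^ 3 = (decodeNat x : K)) →
        v = List.ofFn (fun i : Fin (2 * x.length + 8) => (NumberField.classNumber K).testBit i.val)) ∧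
      ((¬ ∃ (K : Type) (_ : Field K) (_ : NumberField K), Module.finrank ℚ K = 3 ∧
          (∀ r : ℕ, r ^ 3 ≠ decodeNat x) ∧ ∃ α : K, α ^ 3 = (decodeNat x : K)) →
        v = List.replicate (2 * x.length + 8) false) := by
    intro x
    by_contra hcon
    have hempty : {y : List Bool | ∃ v : List Bool, v.length = 2 * x.length + 8 ∧ v <+: y ∧
        (∀ (K : Type) [Field K] [NumberField K], Module.finrank ℚ K = 3 →
          (∀ r : ℕ, r ^ 3 ≠ decodeNat x) → (∃ α : K, α ^ 3 = (decodeNat x : K)) →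
          v = List.ofFn (fun i : Fin (2 * x.length + 8) => (NumberField.classNumber K).testBit i.val)) ∧
        ((¬ ∃ (K : Type) (_ : Field K) (_ : NumberField K), Module.finrank ℚ K = 3 ∧
            (∀ r : ℕ, r ^ 3 ≠ decodeNat x) ∧ ∃ α : K, α ^ 3 = (decodeNat x : K)) →
          v = List.replicate (2 * x.length + 8) false)} = ∅ :=
      Set.subset_empty_iff.mp fun y hy => (hcon ⟨y, hy⟩).elim
    have hx : (2 : ℝ) / 3 ≤ F.kernelProb 0 x ∅ := by
      have h0 := hF x
      beta_reduce at h0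
      rwa [hempty] at h0
    simp [QCircuitFamily.kernelProb] at hx
    norm_num at hx
  choose y v hlen hpre hall hnone using hne
  -- (3) the word is determined by `x`
  have huniq : ∀ (x : List Bool) (v' : List Bool),
      (∀ (K : Type) [Field K] [NumberField K], Module.finrank ℚ K = 3 →
        (∀ r : ℕ, r ^ 3 ≠ decodeNat x) → (∃ α : K, α ^ 3 = (decodeNat x : K)) →
        v' = List.ofFn (fun i : Fin (2 * x.length + 8) => (NumberField.classNumber K).testBit i.val)) →
      ((¬ ∃ (K : Type) (_ : Field K) (_ : NumberField K), Module.finrank ℚ K = 3 ∧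
          (∀ r : ℕ, r ^ 3 ≠ decodeNat x) ∧ ∃ α : K, α ^ 3 = (decodeNat x : K)) →
        v' = List.replicate (2 * x.length + 8) false) →
      v' = v x := by
    intro x v' hall' hnone'
    by_cases hex : ∃ (K : Type) (_ : Field K) (_ : NumberField K), Module.finrank ℚ K = 3 ∧
        (∀ r : ℕ, r ^ 3 ≠ decodeNat x) ∧ ∃ α : K, α ^ 3 = (decodeNat x : K)
    · obtain ⟨K, iF, iN, hdeg, hnc, hα⟩ := hex
      rw [hall' K hdeg hnc hα, hall x K hdeg hnc hα]
    · rw [hnone' hex, hnone x hex]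
  refine ⟨v, ?_, hlen, ?_⟩
  · -- (2)+(3): `f ∈ FBQP`
    show IsQSolvable fun x => {z | v x <+: z}
    refine IsQSolvable.mono ⟨F, hfree, hU, hF⟩ ?_
    intro x z hz
    obtain ⟨v', hlen', hpre', hall', hnone'⟩ := hz
    show v x <+: z
    rw [← huniq x v' hall' hnone']
    exact hpre'
  · -- (4) the value clause
    intro x K _ _ hdeg hnc hα
    exact hall x K hdeg hnc hα

/-- **S5b (composition, sorry-free; skeleton v12 dissolves the glue `stub_subgroupOrderGlue`)**: the subgroup-order solver from the regulator
solver (hypothesis 3) by the advice chain P8 over the class stage P9. -/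
theorem subgroupOrder_of_parts (hSem : ClaimTableSem) (hLaw : ClaimSamplingLaw) :
    (∀ (G : Type) [CommGroup G] (T : ℕ) (c : Fin T → G),
      ∃ φ : Multiplicative (Fin T → ℤ) →* G, (∀ v : Fin T → ℤ, φ (Multiplicative.ofAdd v) = ∏ i, c i ^ v i) ∧
        φ.ker.index = Nat.card (Subgroup.closure (Set.range c))) →
    (∀ (m : ℕ) (ps : List ℕ), (∀ r : ℕ, r ^ 3 ≠ m) →
      ∀ (K : Type) [Field K] [NumberField K] (K' : Type) [Field K'] [NumberField K'],
        Module.finrank ℚ K = 3 → (∃ α : K, α ^ 3 = (m : K)) →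
        Module.finrank ℚ K' = 3 → (∃ α' : K', α' ^ 3 = (m : K')) →
        Nat.card (Subgroup.closure {c : ClassGroup (𝓞 K) | ∃ p ∈ ps, ∃ P : Ideal (𝓞 K),
            ∃ hP : P ∈ nonZeroDivisors (Ideal (𝓞 K)), P.IsPrime ∧ Ideal.absNorm P = p ∧ c = ClassGroup.mk0 ⟨P, hP⟩}) =
          Nat.card (Subgroup.closure {c : ClassGroup (𝓞 K') | ∃ p ∈ ps, ∃ P : Ideal (𝓞 K'),
            ∃ hP : P ∈ nonZeroDivisors (Ideal (𝓞 K')), P.IsPrime ∧ Ideal.absNorm P = p ∧ c = ClassGroup.mk0 ⟨P, hP⟩})) →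
    (IsQSolvable fun w => {y | ∀ (x : List Bool) (f a b k : ℕ),
      w = boolPair (boolPair x (boolPair (encodeNat f) (boolPair (encodeNat a) (encodeNat b)))) (List.replicate k true) →
      decodeNat x = f ^ 3 * (a * b ^ 2) → Squarefree (a * b) →
      ∀ (K : Type) [Field K] [NumberField K], Module.finrank ℚ K = 3 →
        (∀ r : ℕ, r ^ 3 ≠ decodeNat x) → (∃ α : K, α ^ 3 = (decodeNat x : K)) →
        ∃ (r : ℕ) (t : List Bool), y = boolPair (encodeNat r) t ∧
          |(r : ℝ) - 2 ^ k * NumberField.Units.regulator K| ≤ 1}) →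
    IsQSolvable fun w => {y | ∀ (x : List Bool) (f a b : ℕ) (ps : List ℕ),
        w = boolPair x (boolPair (boolPair (encodeNat f) (boolPair (encodeNat a) (encodeNat b)))
          (encodingListNatBool.encode ps)) →
        decodeNat x = f ^ 3 * (a * b ^ 2) → Squarefree (a * b) →
        ∀ (K : Type) [Field K] [NumberField K], Module.finrank ℚ K = 3 →
          (∀ r : ℕ, r ^ 3 ≠ decodeNat x) → (∃ α : K, α ^ 3 = (decodeNat x : K)) →
          (∀ p ∈ ps, p.Prime ∧ ¬ p ∣ 3 * decodeNat x) →
          ∃ t : List Bool, y = boolPair (encodeNat (Nat.card (Subgroup.closure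
            {c : ClassGroup (𝓞 K) | ∃ p ∈ ps, ∃ P : Ideal (𝓞 K), ∃ hP : P ∈ nonZeroDivisors (Ideal (𝓞 K)),
              P.IsPrime ∧ Ideal.absNorm P = p ∧ c = ClassGroup.mk0 ⟨P, hP⟩}))) t} := by
  intro h1 h2 h3
  obtain ⟨qry, hqry, hWF, pre, post, hpre, hpost, F, hfree, hU, hF⟩ := (classStage_of_parts hSem hLaw stub_cubeRootsModP h1 h2).1
  have hincl₁ := (classStage_of_parts hSem hLaw stub_cubeRootsModP h1 h2).2.1
  have hincl₂ := (classStage_of_parts hSem hLaw stub_cubeRootsModP h1 h2).2.2.1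
  have hconv := (classStage_of_parts hSem hLaw stub_cubeRootsModP h1 h2).2.2.2
  refine IsQSolvable.mono (stub_adviceChain _ _ qry _ _ hqry hWF hconv (IsQSolvable.mono h3 fun q y hy => hincl₁ q y hy)
    ⟨pre, post, hpre, hpost, F, hfree, hU, hF⟩) fun w z hz => hincl₂ w z hz

/-- **The line's composition, modulo the two open stubs** (P5b `ClaimTableSem`, P6 `ClaimSamplingLaw`): the crux
`LinnikCubicClassGroups.PureCubicClassGroupFBQP` (stmt-QuantumAdvantage-11544) BY NAME from the table semantics and the sampling
law, every other stub of line `arakelov-giant-step-cycle` being landed. `DegreeOnePrimesEscape` is consumed by S4b only. -/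
theorem PureCubicClassGroupFBQP_of_parts :
    ClaimTableSem → ClaimSamplingLaw → PureCubicClassGroupFBQP := by
  intro hSem hLaw hE
  have hcount := stub_generation stub_cubicFieldFacts hE
  have hcore := subgroupOrder_of_parts hSem hLaw stub_relationLatticeIndex (stub_coreOrderCanonical stub_admissibleFields)
    regulator_of_parts
  exact crux_conclusion_of_canonical (stub_assembly (stub_assemblySampler stub_assemblySamplerAcc) hcount hcore)

end Summit.QuantumAdvantage.QuantumAdvantage.Theorems.LinnikCubicClassGroups
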